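import Summits.BirchSwinnertonDyer.BirchSwinnertonDyer.Theorems.GoldfeldAllTwistsTwoConverseTwinGenusDescentRankZero
import Literature.NumberTheory.EllipticCurves.TwoIsogenyShaTwoTorsion
import Literature.NumberTheory.EllipticCurves.SelmerCorankHolds
import Mathlib.NumberTheory.LegendreSymbol.QuadraticReciprocity
import HarnessLib

set_option linter.dupNamespace false -- `Summit.BirchSwinnertonDyer.BirchSwinnertonDyer.Theorems.…` (summit = sub)
set_option autoImplicit false

/-!
# Crux `HeegnerTwistCouplingInSupply` (stmt-BirchSwinnertonDyer-21381) — card `sqrt2-isogeny-heegner-pin`, CELL-5 PROVED: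
# the complete `2`-isogeny descent of `B_{−m} : y² = x³ − 4m x² + 2m² x` (`j = 8000`, CM by `ℤ[√−2]`) for `m > 0` square-free
# with every prime factor `≡ ±3 (mod 8)`: `S^{(φ̂)}, S^{(φ)} ⊆ {1, 2}`, `rank B_{−m}(ℚ) = 0`, `Ш(B_{−m}/ℚ)[2] = 0`,
# `corank_{ℤ₂} Sel_{2^∞}(B_{−m}/ℚ) = 0` — UNCONDITIONAL (no named fact)

Route `BiquadraticEisensteinDescent` (cell `pub/bsd-wall`, width seat `bsd-wall-cm-bed-w1` g10; `--supports` 21381, helper). The row-12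
lead (`LEAD-VERDICT-ibd-p1-g11` §4) and the card left the `L`-half of the `j = 8000` corner waiting on "ONE Literature typing
(Silverman AEC X.4.9)". None is needed: descent via two-isogeny is PROVED in the tree — `twoIsogenySelmerGroup a b` /
`twoIsogenySelmerGroup' a b` (the Selmer sets `S^{(φ̂)}`, `S^{(φ)}` of `E_{a,b} : y² = x³ + ax² + bx` as finite sets of square-free
divisors, AEC X.4.9 verbatim), `two_pow_twoIsogenySelmerRank_add_eq` (`2^{dim S + dim S′} = 2^{rank+2}·#Ш(V₀)[Ξ]·#Ш(E)[Ξ]`,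
AEC X.4.2(a) counted) and `forall_mem_sha_two_smul_eq_zero_of_halfModel` (`Ш(E′)[φ̂] = Ш(E)[φ] = 0 ⇒ Ш(E)[2] = 0`, AEC III.6.1)
— the engine of the tree's AEC X.6.2 (`TwoIsogenySelmerXCubeAddPXShaTwo`) and of the Goldfeld cell's `[0,42,0,448,0]`
(`…TwinGenusDescentRankZero`). This file runs it on the card's CELL-5, `(a, b) = (−4m, 2m²)`, `(−2a, a² − 4b) = (8m, 8m²)`:

* §1 ★ `not_isSoluble_padic_of_dvd_of_not_isSquare_disc` — if a prime `r` divides all three coefficients of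
  `w² = d u⁴ + a u²z² + d′ z⁴` (`d = r d₁`, `a = r a₁`, `d′ = r e₁`) and `a₁² − 4 d₁ e₁` is a non-residue mod `r`, there is no
  `ℚ_r`-point; `not_isSoluble_padic_of_prime_factor` — on both Selmer sets of `B_{−m}` an odd prime `r ≡ ±3 (mod 8)` dividing `d`
  gives reduced discriminant `2·□`, a non-residue as `(2/r) = −1` (the card's "one symbol `(2/·)` decides the odd part"); the
  `2`-adic residue checks for the classes `−1`, `−2` of `S(8m, 8m²)` (`decide` modulo `8`/`16`, `m` odd);
* §2 `mem_twoIsogenySelmerGroup_phiHat` / `…_phi`: **`S(−4m, 2m²) ⊆ {1, 2}`** (negative classes: no real point) and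
  **`S(8m, 8m²) ⊆ {1, 2}`**; `1 = δ(O)`, `2 ≡ 2m² ≡ 8m² = δ(T)`;
* §3 ★ `rank_eq_zero_and_sha_two_B` — **`rank B_{−m}(ℚ) = 0` and `Ш(B_{−m}/ℚ)[2] = 0`**; ★ `selmerCorank_two_B_eq_zero` —
  **`corank_{ℤ₂} Sel_{2^∞}(B_{−m}/ℚ) = 0`** (Greenberg's identity `selmerCorank_eq_mordellWeilRank_add_holds`).

PARI cross-check (card, kit j311876 (a)): all 257 such `m ≤ 1500` have `ellrank = [0,0,0]`. HONEST FRAMING: unconditional arithmetic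
of one explicit CM family; nothing about `L`-values here (the sequel `…SqrtTwoCorner` adds Burungale–Tian + Deuring–Hecke); the crux
(all CM `W` of analytic rank one; residual C⁺) and BSD are NOT proved by any of this. THEOREMS ONLY; supports stmt-BirchSwinnertonDyer-21381.
-/

noncomputable section

open scoped Classical

namespace Summit.BirchSwinnertonDyer.BirchSwinnertonDyer.Theorems.BiquadraticEisensteinDescentHeegnerTwistCouplingInSupplySqrtTwoCell

open _root_.WeierstrassCurve Literature.NumberTheory.EllipticCurves
open Literature.NumberTheory.EllipticCurves.Zywina2025 (exists_padicInt_of_isSoluble)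
open Summit.BirchSwinnertonDyer.BirchSwinnertonDyer.Theorems.GoldfeldGoodTwists
  (not_isSoluble_two_of_zmodPow mordellWeilRank_congr forall_mem_sha_two_congr)

/-! ## §1 Local lemmas -/

section Local

/-- In `ℤ_r`: `x mod r = 0 ↔ r ∣ x`. [folklore] -/
private theorem toZMod_eq_zero_iff_dvd {r : ℕ} [Fact r.Prime] (x : ℤ_[r]) :
    PadicInt.toZMod x = 0 ↔ (r : ℤ_[r]) ∣ x := by
  rw [← RingHom.mem_ker, PadicInt.ker_toZMod, PadicInt.maximalIdeal_eq_span_p, Ideal.mem_span_singleton]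

/-- ★ **Local lemma: all three coefficients divisible by `r`, reduced discriminant a non-residue.** If `d = r d₁`, `a = r a₁`,
`d′ = r e₁` and `a₁² − 4 d₁ e₁` is not a square modulo the prime `r`, then `w² = d u⁴ + a u²z² + d′ z⁴` has no non-trivial
`ℚ_r`-point: a `ℤ_r`-point `s² = e + a t² + e′ t⁴` in either chart (`(e, e′) = (d, d′)` or `(d′, d)`) has `r ∣ s`, so
`f + a₁ t² + f′ t⁴ ≡ 0 (mod r)` for `(f, f′) = (d₁, e₁)` or `(e₁, d₁)`, and then `a₁² − 4 f f′ = (2 f′ t² + a₁)² (mod r)`.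
(The card's step (ii): "a unit root of `A T² + B T + C` exists only if `B² − 4AC` is a residue".)
[cite: SilvermanAEC2009, Prop. X.4.9 and Example X.4.10] -/
theorem not_isSoluble_padic_of_dvd_of_not_isSquare_disc {r : ℕ} [Fact r.Prime] {a d d' a₁ d₁ e₁ : ℤ}
    (ha : a = r * a₁) (hd : d = r * d₁) (hd' : d' = r * e₁) (hdisc : ¬ IsSquare ((a₁ ^ 2 - 4 * d₁ * e₁ : ℤ) : ZMod r)) :
    ¬ ((twoIsogenyQuartic a d d').map (Int.castRingHom ℚ_[r])).IsSoluble := by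
  have hrr : Prime (r : ℤ_[r]) := PadicInt.prime_p
  intro h
  obtain ⟨e, e', hee, t, s, hs⟩ := exists_padicInt_of_isSoluble h
  obtain ⟨f, f', hf, hf', hdisc'⟩ : ∃ f f' : ℤ, e = r * f ∧ e' = r * f' ∧
      ¬ IsSquare ((a₁ ^ 2 - 4 * f * f' : ℤ) : ZMod r) := by
    rcases hee with ⟨rfl, rfl⟩ | ⟨rfl, rfl⟩
    · exact ⟨d₁, e₁, hd, hd', hdisc⟩
    · exact ⟨e₁, d₁, hd', hd, by rwa [mul_right_comm]⟩
  rw [hf, hf', ha] at hs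
  push_cast at hs
  have hs2 : (r : ℤ_[r]) ∣ s ^ 2 := ⟨f + a₁ * t ^ 2 + f' * t ^ 4, by rw [hs]; ring⟩
  obtain ⟨s₁, rfl⟩ := hrr.dvd_of_dvd_pow hs2
  have h1 : (f : ℤ_[r]) + a₁ * t ^ 2 + f' * t ^ 4 = r * s₁ ^ 2 :=
    mul_left_cancel₀ hrr.ne_zero (by linear_combination -hs)
  have h0 := congrArg PadicInt.toZMod h1
  simp only [map_add, map_mul, map_pow, map_intCast, map_natCast, ZMod.natCast_self, zero_mul] at h0
  refine hdisc' ⟨2 * (f' : ZMod r) * PadicInt.toZMod t ^ 2 + a₁, ?_⟩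
  push_cast
  linear_combination (-4 * (f' : ZMod r)) * h0

/-- `2·c²` with `r ∤ c` is a non-residue modulo a prime `r ≡ ±3 (mod 8)` (second supplementary law, Mathlib
`ZMod.exists_sq_eq_two_iff`). [cite: IrelandRosen1990, Ch. 5 §1 Prop. 5.1.3] -/
theorem not_isSquare_two_mul_sq {r : ℕ} [Fact r.Prime] (hr8 : r % 8 = 3 ∨ r % 8 = 5) {c : ℤ} (hc : ¬ (r : ℤ) ∣ c) :
    ¬ IsSquare ((2 * c ^ 2 : ℤ) : ZMod r) := by
  rintro ⟨y, hy⟩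
  have hc0 : (c : ZMod r) ≠ 0 := by
    rwa [Ne, ZMod.intCast_zmod_eq_zero_iff_dvd]
  have h2 : IsSquare (2 : ZMod r) := ⟨y / c, by
    have : ((2 * c ^ 2 : ℤ) : ZMod r) = 2 * (c : ZMod r) ^ 2 := by push_cast; ring
    field_simp
    rw [← this, hy]; ring⟩
  rcases (ZMod.exists_sq_eq_two_iff (by rintro rfl; omega)).mp h2 with h | h <;> omega

/-- **The odd part of both Selmer sets of `B_{−m}` is killed by `(2/·)`.** Let `m` be square-free, `r ≡ ±3 (mod 8)` a prime factor
of `m`, and `d` a square-free divisor of `β m²` with `r ∣ d`; suppose `α² − 4β = 2c²` with `r ∤ c` (`(α, β, c) = (−4, 2, 2)` for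
`S^{(φ̂)}`, `(8, 8, 4)` for `S^{(φ)}`). Then `w² = d u⁴ + α m u²z² + (β m²/d) z⁴` has no `ℚ_r`-point: all three coefficients are
exactly divisible by `r` and the reduced discriminant is `(α² − 4β)(m/r)² = 2 (c m/r)²`, a non-residue.
[cite: SilvermanAEC2009, Prop. X.4.9] [cite: IrelandRosen1990, Ch. 5 §1 Prop. 5.1.3] -/
theorem not_isSoluble_padic_of_prime_factor {r : ℕ} [Fact r.Prime] (hr8 : r % 8 = 3 ∨ r % 8 = 5) {α β c m d : ℤ}
    (hαβ : α ^ 2 - 4 * β = 2 * c ^ 2) (hc : ¬ (r : ℤ) ∣ c) (hm : Squarefree m) (hrm : (r : ℤ) ∣ m)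
    (hd : Squarefree d) (hrd : (r : ℤ) ∣ d) (hdb : d ∣ β * m ^ 2) :
    ¬ ((twoIsogenyQuartic (α * m) d (β * m ^ 2 / d)).map (Int.castRingHom ℚ_[r])).IsSoluble := by
  have hr : r.Prime := Fact.out
  have hrZ : Prime (r : ℤ) := Nat.prime_iff_prime_int.mp hr
  have hru : ¬ IsUnit (r : ℤ) := hrZ.not_unit
  obtain ⟨m₁, rfl⟩ := hrm
  obtain ⟨d₁, rfl⟩ := hrd
  have hrm₁ : ¬ (r : ℤ) ∣ m₁ := fun h => hru (hm r ⟨m₁ / r, by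
    obtain ⟨k, rfl⟩ := h; rw [Int.mul_ediv_cancel_left _ hrZ.ne_zero]; ring⟩)
  have hrd₁ : ¬ (r : ℤ) ∣ d₁ := fun h => hru (hd r ⟨d₁ / r, by
    obtain ⟨k, rfl⟩ := h; rw [Int.mul_ediv_cancel_left _ hrZ.ne_zero]; ring⟩)
  have hd0 : (r : ℤ) * d₁ ≠ 0 := hd.ne_zero
  -- the complementary divisor `d′ = β m²/d` is `r e₁` with `d₁ e₁ = β m₁²`
  set d' : ℤ := β * (r * m₁) ^ 2 / (r * d₁) with hd'
  have hdd' : r * d₁ * d' = β * (r * m₁) ^ 2 := Int.mul_ediv_cancel' hdb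
  have hre : (r : ℤ) ∣ d₁ * d' := by
    refine ⟨β * m₁ ^ 2, mul_left_cancel₀ hrZ.ne_zero ?_⟩
    linear_combination hdd'
  obtain ⟨e₁, he₁⟩ : (r : ℤ) ∣ d' := (hrZ.dvd_or_dvd hre).resolve_left hrd₁
  have hde : d₁ * e₁ = β * m₁ ^ 2 := by
    have := hdd'
    rw [he₁] at this
    exact mul_left_cancel₀ (pow_ne_zero 2 hrZ.ne_zero) (by linear_combination this)
  refine not_isSoluble_padic_of_dvd_of_not_isSquare_disc (a₁ := α * m₁) (d₁ := d₁) (e₁ := e₁) (by ring) rfl he₁ ?_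
  have key : (α * m₁) ^ 2 - 4 * d₁ * e₁ = 2 * (c * m₁) ^ 2 := by
    rw [mul_assoc 4, hde]; linear_combination m₁ ^ 2 * hαβ
  rw [key]
  exact not_isSquare_two_mul_sq hr8 fun h => (hrZ.dvd_or_dvd h).elim hc hrm₁

/-- Residues for the class `−1` of `S(8m, 8m²)` (`w² = −u⁴ + 8m u²z² − 8m² z⁴`, `m = 2M + 1` odd): chart `u = 1` modulo `8`
(`s² ≡ −1`), chart `z = 1` modulo `16` (`s² ≡ 15` for `t` odd, `≡ 8` for `t` even). [folklore] -/
theorem zmod_key_neg_one :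
    (∀ M T S : ZMod (2 ^ 3), S ^ 2 ≠ -1 + 8 * (2 * M + 1) * T ^ 2 + -(8 * (2 * M + 1) ^ 2) * T ^ 4) ∧
    (∀ M T S : ZMod (2 ^ 4), S ^ 2 ≠ -(8 * (2 * M + 1) ^ 2) + 8 * (2 * M + 1) * T ^ 2 + -1 * T ^ 4) :=
  ⟨by decide, by decide⟩

/-- Residues for the class `−2` of `S(8m, 8m²)` (`w² = −2u⁴ + 8m u²z² − 4m² z⁴`, `m = 2M + 1` odd): chart `u = 1` modulo `8`
(`s² ≡ 2, 6`), chart `z = 1` modulo `16` (`s² ≡ 2` for `t` odd, `≡ 12` for `t` even). [folklore] -/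
theorem zmod_key_neg_two :
    (∀ M T S : ZMod (2 ^ 3), S ^ 2 ≠ -2 + 8 * (2 * M + 1) * T ^ 2 + -(4 * (2 * M + 1) ^ 2) * T ^ 4) ∧
    (∀ M T S : ZMod (2 ^ 4), S ^ 2 ≠ -(4 * (2 * M + 1) ^ 2) + 8 * (2 * M + 1) * T ^ 2 + -2 * T ^ 4) :=
  ⟨by decide, by decide⟩

/-- The class `−1` of `S(8m, 8m²)`, `m` odd, has no `ℚ₂`-point. [cite: SilvermanAEC2009, Prop. X.4.9] -/
theorem not_isSoluble_two_neg_one {m : ℤ} (hm : Odd m) :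
    ¬ ((twoIsogenyQuartic (8 * m) (-1) (-(8 * m ^ 2))).map (Int.castRingHom ℚ_[2])).IsSoluble := by
  obtain ⟨M, rfl⟩ := hm
  refine not_isSoluble_two_of_zmodPow 3 4 (fun T S => ?_) (fun T S => ?_)
  · have := zmod_key_neg_one.1 (M : ZMod (2 ^ 3)) T S
    push_cast
    convert this using 2
  · have := zmod_key_neg_one.2 (M : ZMod (2 ^ 4)) T S
    push_cast
    convert this using 2

/-- The class `−2` of `S(8m, 8m²)`, `m` odd, has no `ℚ₂`-point. [cite: SilvermanAEC2009, Prop. X.4.9] -/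
theorem not_isSoluble_two_neg_two {m : ℤ} (hm : Odd m) :
    ¬ ((twoIsogenyQuartic (8 * m) (-2) (-(4 * m ^ 2))).map (Int.castRingHom ℚ_[2])).IsSoluble := by
  obtain ⟨M, rfl⟩ := hm
  refine not_isSoluble_two_of_zmodPow 3 4 (fun T S => ?_) (fun T S => ?_)
  · have := zmod_key_neg_two.1 (M : ZMod (2 ^ 3)) T S
    push_cast
    convert this using 2
  · have := zmod_key_neg_two.2 (M : ZMod (2 ^ 4)) T S
    push_cast
    convert this using 2

end Local

/-! ## §2 The two Selmer sets of `B_{−m}`: `S(−4m, 2m²) ⊆ {1, 2}` and `S(8m, 8m²) ⊆ {1, 2}` -/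

section Selmer

variable {m : ℤ}

/-- If every prime factor of `m` is `≡ 3, 5 (mod 8)` then `m` is odd. [folklore] -/
theorem odd_of_prime_factors_mod_eight (hm8 : ∀ r : ℕ, r.Prime → (r : ℤ) ∣ m → r % 8 = 3 ∨ r % 8 = 5) : Odd m := by
  refine (Int.even_or_odd m).resolve_left fun ⟨k, hk⟩ => ?_
  have := hm8 2 Nat.prime_two ⟨k, by rw [hk]; ring⟩
  omega

/-- A square-free integer whose only possible prime factor is `2` is `±1` or `±2`. [folklore] -/
theorem natAbs_eq_one_or_two_of_squarefree {d : ℤ} (hd : Squarefree d) (h2 : ∀ q : ℕ, q.Prime → (q : ℤ) ∣ d → q = 2) :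
    d.natAbs = 1 ∨ d.natAbs = 2 := by
  have hd0 : d.natAbs ≠ 0 := Int.natAbs_ne_zero.mpr hd.ne_zero
  have hsq : Squarefree d.natAbs := Int.squarefree_natAbs.mpr hd
  have hpow := Nat.eq_prime_pow_of_unique_prime_dvd hd0 (p := 2)
    (fun {q} hq hqd => h2 q hq (Int.ofNat_dvd_left.mpr hqd))
  set k := d.natAbs.primeFactorsList.length
  by_cases hk : k = 0
  · exact Or.inl (by rw [hpow, hk, pow_zero])
  · rw [hpow] at hsq ⊢
    exact Or.inr (by rw [((Nat.squarefree_pow_iff (by norm_num) hk).mp hsq).2, pow_one])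

/-- An odd prime dividing a divisor `d` of `β m²` with `β ∈ {2, 8}` divides `m`. [folklore] -/
theorem dvd_of_prime_dvd_of_dvd_mul_sq {r : ℕ} (hr : r.Prime) (hr2 : r ≠ 2) {β d : ℤ} (hβ : β = 2 ∨ β = 8)
    (hrd : (r : ℤ) ∣ d) (hdb : d ∣ β * m ^ 2) : (r : ℤ) ∣ m := by
  have hrZ : Prime (r : ℤ) := Nat.prime_iff_prime_int.mp hr
  rcases hrZ.dvd_or_dvd (hrd.trans hdb) with h | h
  · exfalso
    have h8 : (r : ℤ) ∣ (2 : ℤ) ^ 3 := by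
      rcases hβ with rfl | rfl
      · exact h.trans ⟨4, by norm_num⟩
      · exact h.trans ⟨1, by norm_num⟩
    have h2 : r ∣ 2 := by
      have := hrZ.dvd_of_dvd_pow h8
      exact_mod_cast this
    exact hr2 ((Nat.prime_dvd_prime_iff_eq hr Nat.prime_two).mp h2)
  · exact hrZ.dvd_of_dvd_pow h

/-- An odd prime does not divide `2` or `4`. [folklore] -/
theorem not_dvd_two_pow_of_odd_prime {r : ℕ} (hr : r.Prime) (hr2 : r ≠ 2) {k : ℕ} : ¬ (r : ℤ) ∣ (2 : ℤ) ^ k := by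
  intro h
  have h2 : r ∣ 2 := by exact_mod_cast (Nat.prime_iff_prime_int.mp hr).dvd_of_dvd_pow h
  exact hr2 ((Nat.prime_dvd_prime_iff_eq hr Nat.prime_two).mp h2)

/-- **`S(−4m, 2m²) ⊆ {1, 2}`** — the descent-on-divisors-of-`b` Selmer set (`S^{(φ̂)}(B′_{−m}/ℚ)`, receiving `B_{−m}(ℚ)/φ̂`) of
`B_{−m} : y² = x³ − 4m x² + 2m² x`, for `m > 0` square-free with all prime factors `≡ ±3 (mod 8)`: a class with an odd prime factor
`r` dies `r`-adically (`(2/r) = −1`), a negative class dies over `ℝ` (all coefficients `< 0`); `1 = δ(O)` and `2 ≡ 2m² = δ(T)` remain.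
(Card CELL-5 steps (i)–(ii).) [cite: SilvermanAEC2009, Prop. X.4.9 and Remark X.4.9.1] -/
theorem mem_twoIsogenySelmerGroup_phiHat (hm0 : 0 < m) (hm : Squarefree m)
    (hm8 : ∀ r : ℕ, r.Prime → (r : ℤ) ∣ m → r % 8 = 3 ∨ r % 8 = 5) {d : ℤ}
    (h : d ∈ twoIsogenySelmerGroup (-4 * m) (2 * m ^ 2)) : d = 1 ∨ d = 2 := by
  have hb : (2 * m ^ 2 : ℤ) ≠ 0 := by positivity
  obtain ⟨hsq, hdvd, hloc⟩ := (mem_twoIsogenySelmerGroup_iff hb).mp h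
  by_cases hodd : ∃ r : ℕ, r.Prime ∧ r ≠ 2 ∧ (r : ℤ) ∣ d
  · obtain ⟨r, hr, hr2, hrd⟩ := hodd
    exfalso
    haveI : Fact r.Prime := ⟨hr⟩
    have hrm : (r : ℤ) ∣ m := dvd_of_prime_dvd_of_dvd_mul_sq hr hr2 (Or.inl rfl) hrd hdvd
    exact not_isSoluble_padic_of_prime_factor (hm8 r hr hrm) (α := -4) (β := 2) (c := 2) (by norm_num)
      (by simpa using not_dvd_two_pow_of_odd_prime hr hr2 (k := 1)) hm hrm hsq hrd hdvd
      (by simpa [neg_mul] using hloc.2 r)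
  · push Not at hodd
    have habs := natAbs_eq_one_or_two_of_squarefree hsq fun q hq hqd => by
      by_contra hq2
      exact hodd q hq hq2 hqd
    rcases Int.natAbs_eq d with hpos | hneg
    · rcases habs with h1 | h2 <;> omega
    · exfalso
      have hd0 : d < 0 := by rcases habs with h1 | h2 <;> omega
      have hmul : d * (2 * m ^ 2 / d) = 2 * m ^ 2 := Int.mul_ediv_cancel' hdvd
      have hd'0 : 2 * m ^ 2 / d < 0 := by
        by_contra hq
        push Not at hq
        nlinarith [mul_nonneg (neg_pos.mpr hd0).le hq, mul_pos hm0 hm0]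
      exact not_isSoluble_real_twoIsogenyQuartic_of_neg hd0 hd'0 (by omega) hloc.1

/-- **`S(8m, 8m²) ⊆ {1, 2}`** — the descent on the divisors of `a² − 4b = 8m²` (`S^{(φ)}(B_{−m}/ℚ)`, receiving `B′_{−m}(ℚ)/φ`),
same `m`: a class with an odd prime factor dies `r`-adically (`(2/r) = −1`), the classes `−1`, `−2` die `2`-adically (residues
mod `8`/`16`); `1` and `2 ≡ 8m²` remain. (Card CELL-5 steps (ii)–(iii).) [cite: SilvermanAEC2009, Prop. X.4.9] -/
theorem mem_twoIsogenySelmerGroup_phi (hm0 : 0 < m) (hm : Squarefree m)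
    (hm8 : ∀ r : ℕ, r.Prime → (r : ℤ) ∣ m → r % 8 = 3 ∨ r % 8 = 5) {d : ℤ}
    (h : d ∈ twoIsogenySelmerGroup (8 * m) (8 * m ^ 2)) : d = 1 ∨ d = 2 := by
  haveI : Fact (Nat.Prime 2) := ⟨Nat.prime_two⟩
  have hb : (8 * m ^ 2 : ℤ) ≠ 0 := by positivity
  have hodd_m : Odd m := odd_of_prime_factors_mod_eight hm8
  obtain ⟨hsq, hdvd, hloc⟩ := (mem_twoIsogenySelmerGroup_iff hb).mp h
  by_cases hodd : ∃ r : ℕ, r.Prime ∧ r ≠ 2 ∧ (r : ℤ) ∣ d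
  · obtain ⟨r, hr, hr2, hrd⟩ := hodd
    exfalso
    haveI : Fact r.Prime := ⟨hr⟩
    have hrm : (r : ℤ) ∣ m := dvd_of_prime_dvd_of_dvd_mul_sq hr hr2 (Or.inr rfl) hrd hdvd
    exact not_isSoluble_padic_of_prime_factor (hm8 r hr hrm) (α := 8) (β := 8) (c := 4) (by norm_num)
      (by simpa using not_dvd_two_pow_of_odd_prime hr hr2 (k := 2)) hm hrm hsq hrd hdvd (hloc.2 r)
  · push Not at hodd
    have habs := natAbs_eq_one_or_two_of_squarefree hsq fun q hq hqd => by
      by_contra hq2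
      exact hodd q hq hq2 hqd
    rcases Int.natAbs_eq d with hpos | hneg
    · rcases habs with h1 | h2 <;> omega
    · exfalso
      rcases habs with h1 | h2
      · have hd1 : d = -1 := by omega
        subst hd1
        have h2' := hloc.2 2
        rw [Int.ediv_neg, Int.ediv_one] at h2'
        exact not_isSoluble_two_neg_one hodd_m h2'
      · have hd2 : d = -2 := by omega
        subst hd2
        have h2' := hloc.2 2
        rw [Int.ediv_neg, show (8 * m ^ 2 : ℤ) = 2 * (4 * m ^ 2) by ring,
          Int.mul_ediv_cancel_left _ (two_ne_zero)] at h2'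
        exact not_isSoluble_two_neg_two hodd_m h2'

/-- `S′(−4m, 2m²) = S(8m, 8m²)` (`−2a = 8m`, `a² − 4b = 16m² − 8m² = 8m²`). [folklore] -/
theorem twoIsogenySelmerGroup'_B (m : ℤ) :
    twoIsogenySelmerGroup' (-4 * m) (2 * m ^ 2) = twoIsogenySelmerGroup (8 * m) (8 * m ^ 2) := by
  rw [twoIsogenySelmerGroup'_eq]
  congr 1 <;> ring

/-- `#S(−4m, 2m²) ≤ 2`. [cite: SilvermanAEC2009, Prop. X.4.9] -/
theorem card_twoIsogenySelmerGroup_B_le (hm0 : 0 < m) (hm : Squarefree m)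
    (hm8 : ∀ r : ℕ, r.Prime → (r : ℤ) ∣ m → r % 8 = 3 ∨ r % 8 = 5) :
    (twoIsogenySelmerGroup (-4 * m) (2 * m ^ 2)).card ≤ 2 :=
  le_trans (Finset.card_le_card fun d hd => by
    have := mem_twoIsogenySelmerGroup_phiHat hm0 hm hm8 hd
    simp only [Finset.mem_insert, Finset.mem_singleton]
    exact this) (Finset.card_le_two (a := (1 : ℤ)) (b := 2))

/-- `#S′(−4m, 2m²) = #S(8m, 8m²) ≤ 2`. [cite: SilvermanAEC2009, Prop. X.4.9] -/
theorem card_twoIsogenySelmerGroup'_B_le (hm0 : 0 < m) (hm : Squarefree m)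
    (hm8 : ∀ r : ℕ, r.Prime → (r : ℤ) ∣ m → r % 8 = 3 ∨ r % 8 = 5) :
    (twoIsogenySelmerGroup' (-4 * m) (2 * m ^ 2)).card ≤ 2 := by
  rw [twoIsogenySelmerGroup'_B]
  exact le_trans (Finset.card_le_card fun d hd => by
    have := mem_twoIsogenySelmerGroup_phi hm0 hm hm8 hd
    simp only [Finset.mem_insert, Finset.mem_singleton]
    exact this) (Finset.card_le_two (a := (1 : ℤ)) (b := 2))

end Selmer

/-! ## §3 `rank B_{−m}(ℚ) = 0`, `Ш(B_{−m}/ℚ)[2] = 0`, `corank_{ℤ₂} Sel_{2^∞}(B_{−m}/ℚ) = 0` -/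

section RankZero

variable {m : ℤ}

/-- Arithmetic core: `k = 2^{r+2} (n₁ n₂) ≤ 4`, `k > 0` ⇒ `r = 0` and `n₁ = n₂ = 1`. [folklore] -/
private theorem rank_zero_arith {r n₁ n₂ k : ℕ} (hk : k = 2 ^ (r + 2) * (n₁ * n₂)) (hk4 : k ≤ 4)
    (hkpos : 0 < k) : r = 0 ∧ n₁ = 1 ∧ n₂ = 1 := by
  subst hk
  have hn₁ : 0 < n₁ := Nat.pos_of_ne_zero (by rintro rfl; simp at hkpos)
  have hn₂ : 0 < n₂ := Nat.pos_of_ne_zero (by rintro rfl; simp at hkpos)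
  have h2 : 2 ^ (r + 2) ≤ 4 := le_trans (Nat.le_mul_of_pos_right _ (Nat.mul_pos hn₁ hn₂)) hk4
  have hr : r = 0 := by
    by_contra hr
    have h8 : 2 ^ 3 ≤ 2 ^ (r + 2) := Nat.pow_le_pow_right (by norm_num) (by omega)
    omega
  subst hr
  norm_num at hk4
  refine ⟨rfl, ?_, ?_⟩ <;> nlinarith

/-- `b (a² − 4b) = 16 m⁴ ≠ 0` for `(a, b) = (−4m, 2m²)`, `m ≠ 0`. [folklore] -/
theorem hab_B (hm : m ≠ 0) : (2 * m ^ 2 : ℤ) * ((-4 * m) ^ 2 - 4 * (2 * m ^ 2)) ≠ 0 := by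
  rw [show (2 * m ^ 2 : ℤ) * ((-4 * m) ^ 2 - 4 * (2 * m ^ 2)) = 16 * m ^ 4 by ring]
  exact mul_ne_zero (by norm_num) (pow_ne_zero 4 hm)

/-- The tree's cast literal `E_{−4m, 2m²}` is `B_{−m} = ⟨0, −4m, 0, 2m², 0⟩`. [folklore] -/
theorem lit_B (m : ℤ) :
    (⟨0, ((-4 * m : ℤ) : ℚ), 0, ((2 * m ^ 2 : ℤ) : ℚ), 0⟩ : WeierstrassCurve ℚ) = ⟨0, -4 * (m : ℚ), 0, 2 * (m : ℚ) ^ 2, 0⟩ := by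
  ext <;> push_cast <;> rfl

/-- `B_{−m}` is an elliptic curve for `m ≠ 0` (`Δ = 2⁹ m⁶`). [cite: SilvermanAEC2009, Prop. X.4.9] -/
theorem isElliptic_B (hm : m ≠ 0) : (⟨0, -4 * (m : ℚ), 0, 2 * (m : ℚ) ^ 2, 0⟩ : WeierstrassCurve ℚ).IsElliptic := by
  rw [← lit_B]
  exact isElliptic_mk_of_ne_zero (F := ℚ) (hab_B hm)

/-- ★ **CELL-5: `rank B_{−m}(ℚ) = 0` and `Ш(B_{−m}/ℚ)[2] = 0`** for `B_{−m} : y² = x³ − 4m x² + 2m² x`, `m > 0` square-free with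
every prime factor `≡ ±3 (mod 8)` — UNCONDITIONAL: the counted Kummer sequences `#S·#S′ = 2^{rank+2}·#Ш(B′)[φ̂]·#Ш(B)[φ]`
(`two_pow_twoIsogenySelmerRank_add_eq`, AEC X.4.2(a)) with `#S, #S′ ≤ 2` force `rank = 0` and both `φ`-parts trivial, whence
`Ш[2] = 0` (`forall_mem_sha_two_smul_eq_zero_of_halfModel`, AEC III.6.1). (Card: "`Sel₂(B_{−m}/ℚ) = ℤ/2`, rank 0, Ш[2] = 0";
PARI 257/257.) [cite: SilvermanAEC2009, Thm. X.4.2(a), Prop. X.4.9, Example X.4.10] -/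
theorem rank_eq_zero_and_sha_two_B (hm0 : 0 < m) (hm : Squarefree m)
    (hm8 : ∀ r : ℕ, r.Prime → (r : ℤ) ∣ m → r % 8 = 3 ∨ r % 8 = 5) :
    (⟨0, -4 * (m : ℚ), 0, 2 * (m : ℚ) ^ 2, 0⟩ : WeierstrassCurve ℚ).mordellWeilRank = 0 ∧
      ∀ c ∈ (⟨0, -4 * (m : ℚ), 0, 2 * (m : ℚ) ^ 2, 0⟩ : WeierstrassCurve ℚ).sha, 2 • c = 0 → c = 0 := by
  have hab := hab_B hm0.ne'
  haveI := isElliptic_halfModel hab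
  haveI := isElliptic_mk_of_ne_zero (F := ℚ) hab
  haveI := isElliptic_B hm0.ne'
  have key := two_pow_twoIsogenySelmerRank_add_eq hab
  have h4 : 2 ^ (twoIsogenySelmerRank (-4 * m) (2 * m ^ 2) + twoIsogenySelmerRank' (-4 * m) (2 * m ^ 2)) ≤ 4 := by
    rw [pow_add, two_pow_twoIsogenySelmerRank_eq_card hab, two_pow_twoIsogenySelmerRank'_eq_card hab]
    exact Nat.mul_le_mul (card_twoIsogenySelmerGroup_B_le hm0 hm hm8) (card_twoIsogenySelmerGroup'_B_le hm0 hm hm8)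
  obtain ⟨hr, h₁, h₂⟩ := rank_zero_arith key h4 (pow_pos two_pos _)
  have hsha := forall_mem_sha_two_smul_eq_zero_of_halfModel (AddSubgroup.eq_bot_of_card_eq _ h₁)
    (AddSubgroup.eq_bot_of_card_eq _ h₂)
  refine ⟨?_, forall_mem_sha_two_congr (lit_B m).symm hsha⟩
  rw [← mordellWeilRank_congr (lit_B m)]
  exact hr

/-- ★ **CELL-5, corank form: `corank_{ℤ₂} Sel_{2^∞}(B_{−m}/ℚ) = 0`** (same `m`): `corank Sel = rank + corank Ш[2^∞]`
(Greenberg, tree theorem `selmerCorank_eq_mordellWeilRank_add_holds`) with `rank = 0` and `Ш[2] = 0 ⇒ corank Ш[2^∞] = 0`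
(`shaCorank_eq_zero_of_forall`). This is the hypothesis of Burungale–Tian's rank-zero `2`-converse. The instance argument is
`isElliptic_B`. [cite: SilvermanAEC2009, Thm. X.4.2(a) and Prop. X.4.9] [cite: Greenberg1999, §1] -/
theorem selmerCorank_two_B_eq_zero (hm0 : 0 < m) (hm : Squarefree m)
    (hm8 : ∀ r : ℕ, r.Prime → (r : ℤ) ∣ m → r % 8 = 3 ∨ r % 8 = 5)
    [hE : (⟨0, -4 * (m : ℚ), 0, 2 * (m : ℚ) ^ 2, 0⟩ : WeierstrassCurve ℚ).IsElliptic] :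
    (⟨0, -4 * (m : ℚ), 0, 2 * (m : ℚ) ^ 2, 0⟩ : WeierstrassCurve ℚ).selmerCorank 2 = 0 := by
  haveI : Fact (Nat.Prime 2) := ⟨Nat.prime_two⟩
  obtain ⟨hr, hsha⟩ := rank_eq_zero_and_sha_two_B hm0 hm hm8
  rw [(⟨0, -4 * (m : ℚ), 0, 2 * (m : ℚ) ^ 2, 0⟩ : WeierstrassCurve ℚ).selmerCorank_eq_mordellWeilRank_add_holds 2, hr,
    (⟨0, -4 * (m : ℚ), 0, 2 * (m : ℚ) ^ 2, 0⟩ : WeierstrassCurve ℚ).shaCorank_eq_zero_of_forall 2 hsha]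

end RankZero

end Summit.BirchSwinnertonDyer.BirchSwinnertonDyer.Theorems.BiquadraticEisensteinDescentHeegnerTwistCouplingInSupplySqrtTwoCell

end
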